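import Summits.QuantumFields.YangMills.Theorems.DirichletWindowAllSidesChessboardEvenRows
import HarnessLib

/-!
# Plaquette sets of ALL orientations on the even torus — the two reflection Cauchy–Schwarz inequalities of the axis `0`

Support file for item stmt-QuantumFields-20194 (`DirichletWindow.AllSidesCouplingChessboard`, K1 of the large-field
sparsity line; seat ym-dw-p1 g3).

For the Chebyshev functional `Ψ(A) = ⟨exp(c ∑_{q ∈ plaqsE A} φ_q)⟩_{Λ,β}` (`mpsiE`) of a family of corner patterns on the
even torus `(ℤ/L)^d`, `0 ≤ c ≤ β`:

* `mpsiE_link_sq_le_zero`: `Ψ(A)² ≤ Ψ(L⁺A) · Ψ(L⁻A)` for the Osterwalder–Seiler LINK reflection of the axis `0`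
  (between the slices `0 | 1` and `L/2 | L/2 + 1`): `L^± A` symmetrises the orientations transverse to `0` with the open
  symmetrisations `symP/symM 0 1` and the orientations containing `0` with the site-type closed symmetrisations
  `ssymP/ssymM 0 0` (cut slabs kept once, weighted by the positive-definite cut weights of
  `sq_wilsonExpectation_mul_timeReflect_mul_expObs_le_even`);
* `mpsiE_site_sq_le_zero`: `Ψ(A)² ≤ Ψ(S⁺A) · Ψ(S⁻A)` for the SITE reflection through the slices `0` and `L/2`: `S^± A`
  symmetrises transverse orientations with `ssymP/ssymM 0 0` (shared layers kept once; their weight is a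
  `Θ'`-invariant function of the shared links and is absorbed into both factors) and in-plane orientations with
  `symP/symM 0 0` (site reflection positivity holds for every real `β`; `sq_integral_mul_negReflect_le`).

Base inequalities for `twisted_chessboard_le_rpow_even_of_base`; finite-torus bookkeeping, no claim about the mass gap.
-/

noncomputable section

open MeasureTheory Finset
open Literature.MathematicalPhysics.QuantumFieldTheory
open Literature.MathematicalPhysics.QuantumFieldTheory.WilsonRP
open Literature.MathematicalPhysics.QuantumFieldTheory.WilsonSiteRP
open Literature.Barriers.CriticalPhenomena.NonGibbs
open Literature.Probability.LatticeModels
open Summit.QuantumFields.YangMills.Theorems.SoloBlind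
open Summit.QuantumFields.YangMills.Theorems.OddTorusChessboard

namespace Summit.QuantumFields.YangMills.Theorems.AllSidesChessboard

variable {d L N : ℕ} [NeZero d] [NeZero L] {G : Type*} [Group G] [TopologicalSpace G]
  [IsTopologicalGroup G] [CompactSpace G] [MeasurableSpace G] [BorelSpace G]
  (ρ : G →* Matrix (Fin N) (Fin N) ℂ)

/-! ### §1. The reflected families -/

section Refl

omit [NeZero L]

/-- The LINK-reflected family: `sreflect 0 0` on in-plane components, `cellReflect 0 1` on transverse ones. -/
def linkRefl (X : Orient d → Finset (BlockIdx d L)) : Orient d → Finset (BlockIdx d L) :=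
  fun o => if o.1.1 = 0 then (X o).image (sreflect 0 0) else (X o).image (cellReflect 0 1)

/-- The SITE-reflected family: `cellReflect 0 0` on in-plane components, `sreflect 0 0` on transverse ones. -/
def siteRefl (X : Orient d → Finset (BlockIdx d L)) : Orient d → Finset (BlockIdx d L) :=
  fun o => if o.1.1 = 0 then (X o).image (cellReflect 0 0) else (X o).image (sreflect 0 0)

/-- The plaquette set of the LINK-reflected family. -/
theorem plaqsE_linkRefl (X : Orient d → Finset (BlockIdx d L)) : plaqsE (linkRefl X) = (plaqsE X).image plaqReflect :=
  plaqsE_reflect_link X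

/-- The plaquette set of the SITE-reflected family. -/
theorem plaqsE_siteRefl (X : Orient d → Finset (BlockIdx d L)) :
    plaqsE (siteRefl X) = (plaqsE X).image sitePlaqReflect :=
  plaqsE_reflect_site X

end Refl

/-! ### §2. The LINK core step -/

section LinkCore

/-- **LINK core step.**  For componentwise disjoint families `X` (positive plaquettes), `F` (cut plaquettes) and `Y`
(whose link reflections are positive): `Ψ(X ∪ F ∪ Y)² ≤ Ψ(X ∪ F ∪ ϑX) · Ψ(ϑY ∪ F ∪ Y)` (`L` even, `0 ≤ c ≤ β`). -/
theorem mpsiE_link_core (hL : Even L) (hρ : Continuous ρ) {β c : ℝ} (hc : 0 ≤ c) (hcβ : c ≤ β)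
    {X F Y : Orient d → Finset (BlockIdx d L)}
    (hXF : ∀ o, Disjoint (X o) (F o)) (hXFY : ∀ o, Disjoint (X o ∪ F o) (Y o))
    (hXFθ : ∀ o, Disjoint (X o ∪ F o) (linkRefl X o))
    (hθFY : ∀ o, Disjoint (linkRefl Y o ∪ F o) (Y o)) (hθF : ∀ o, Disjoint (linkRefl Y o) (F o))
    (hX : ∀ q ∈ plaqsE X, IsPosPlaq q) (hY : ∀ q ∈ plaqsE (linkRefl Y), IsPosPlaq q)
    (hF : ∀ q ∈ plaqsE F, IsCrossPlaq q) :
    mpsiE (G := G) ρ β c (fun o => X o ∪ F o ∪ Y o) ^ 2 ≤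
      mpsiE ρ β c (fun o => X o ∪ F o ∪ linkRefl X o) * mpsiE ρ β c (fun o => linkRefl Y o ∪ F o ∪ Y o) := by
  haveI : Fact (1 < L) := ⟨by obtain ⟨r, hr⟩ := hL; have := NeZero.ne L; omega⟩
  set PX : Finset (Plaquette d L) := plaqsE X with hPX
  set PF : Finset (Plaquette d L) := plaqsE F with hPF
  set PY : Finset (Plaquette d L) := plaqsE Y with hPY
  set PθX : Finset (Plaquette d L) := plaqsE (linkRefl X) with hPθX
  set PθY : Finset (Plaquette d L) := plaqsE (linkRefl Y) with hPθY
  have hθX : PθX = PX.image plaqReflect := plaqsE_linkRefl X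
  have hθY : PθY = PY.image plaqReflect := plaqsE_linkRefl Y
  have dXF : Disjoint PX PF := disjoint_plaqsE hXF
  have dXFY : Disjoint (PX ∪ PF) PY := by rw [hPX, hPF, ← plaqsE_union]; exact disjoint_plaqsE hXFY
  have dXFθ : Disjoint (PX ∪ PF) PθX := by rw [hPX, hPF, ← plaqsE_union]; exact disjoint_plaqsE hXFθ
  have dθFY : Disjoint (PθY ∪ PF) PY := by rw [hPθY, hPF, ← plaqsE_union]; exact disjoint_plaqsE hθFY
  have dθF : Disjoint PθY PF := disjoint_plaqsE hθF
  set Fo : GaugeConfig d L G → ℝ := expObs ρ c PX with hFo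
  set Go : GaugeConfig d L G → ℝ := expObs ρ c PθY with hGo
  obtain ⟨F₀, hFb⟩ := exists_abs_expObs_le (G := G) ρ hρ c PX
  obtain ⟨G₀, hGb⟩ := exists_abs_expObs_le (G := G) ρ hρ c PθY
  have key := sq_wilsonExpectation_mul_timeReflect_mul_expObs_le_even ρ hL hρ hc hcβ
    (measurable_expObs ρ hρ c _) hFb (dependsOn_expObs_of_isPosPlaq ρ c hX)
    (measurable_expObs ρ hρ c _) hGb (dependsOn_expObs_of_isPosPlaq ρ c hY) PF hF
  have hθθY : PθY.image plaqReflect = PY := by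
    rw [hθY, Finset.image_image]
    convert Finset.image_id (s := PY) using 2
    funext q; exact plaqReflect_plaqReflect q
  have hGoΘ : ∀ U : GaugeConfig d L G, Go U.timeReflect = expObs ρ c PY U := by
    intro U; rw [hGo, expObs_timeReflect ρ hρ, hθθY]
  have hFoΘ : ∀ U : GaugeConfig d L G, Fo U.timeReflect = expObs ρ c PθX U := by
    intro U; rw [hFo, expObs_timeReflect ρ hρ, hθX]
  have e1 : (wilsonExpectation ρ β fun U : GaugeConfig d L G => Fo U * Go U.timeReflect * expObs ρ c PF U) =
      mpsiE ρ β c (fun o => X o ∪ F o ∪ Y o) := by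
    unfold mpsiE
    congr 1
    funext U
    rw [plaqsE_union₃, ← hPX, ← hPF, ← hPY, ← expObs_mul_of_disjoint ρ c dXFY, ← expObs_mul_of_disjoint ρ c dXF,
      hGoΘ, hFo]
    ring
  have e2 : (wilsonExpectation ρ β fun U : GaugeConfig d L G => Fo U * Fo U.timeReflect * expObs ρ c PF U) =
      mpsiE ρ β c (fun o => X o ∪ F o ∪ linkRefl X o) := by
    unfold mpsiE
    congr 1
    funext U
    rw [plaqsE_union₃, ← hPX, ← hPF, ← hPθX, ← expObs_mul_of_disjoint ρ c dXFθ,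
      ← expObs_mul_of_disjoint ρ c dXF, hFoΘ, hFo]
    ring
  have e3 : (wilsonExpectation ρ β fun U : GaugeConfig d L G => Go U * Go U.timeReflect * expObs ρ c PF U) =
      mpsiE ρ β c (fun o => linkRefl Y o ∪ F o ∪ Y o) := by
    unfold mpsiE
    congr 1
    funext U
    rw [plaqsE_union₃, ← hPθY, ← hPF, ← hPY, ← expObs_mul_of_disjoint ρ c dθFY,
      ← expObs_mul_of_disjoint ρ c dθF, hGoΘ, hGo]
    ring
  rw [e1, e2, e3] at key
  exact key

end LinkCore

/-! ### §3. The SITE core step -/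

section SiteCore

/-- **SITE core step.**  For componentwise disjoint families `X` (site-positive plaquettes), `F` (shared plaquettes)
and `Y` (whose site reflections are site-positive): `Ψ(X ∪ F ∪ Y)² ≤ Ψ(X ∪ F ∪ ϑ'X) · Ψ(ϑ'Y ∪ F ∪ Y)` (`L` even, any
real `β`, `c`; the shared weight is absorbed into both half-observables). -/
theorem mpsiE_site_core (hL : Even L) (hρ : Continuous ρ) (β c : ℝ)
    {X F Y : Orient d → Finset (BlockIdx d L)}
    (hXF : ∀ o, Disjoint (X o) (F o)) (hXFY : ∀ o, Disjoint (X o ∪ F o) (Y o))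
    (hXFθ : ∀ o, Disjoint (X o ∪ F o) (siteRefl X o))
    (hθFY : ∀ o, Disjoint (siteRefl Y o ∪ F o) (Y o)) (hθF : ∀ o, Disjoint (siteRefl Y o) (F o))
    (hX : ∀ q ∈ plaqsE X, IsSitePosPlaq q) (hY : ∀ q ∈ plaqsE (siteRefl Y), IsSitePosPlaq q)
    (hF : ∀ q ∈ plaqsE F, IsSharedPlaq q) :
    mpsiE (G := G) ρ β c (fun o => X o ∪ F o ∪ Y o) ^ 2 ≤
      mpsiE ρ β c (fun o => X o ∪ F o ∪ siteRefl X o) * mpsiE ρ β c (fun o => siteRefl Y o ∪ F o ∪ Y o) := by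
  haveI : Fact (1 < L) := ⟨by obtain ⟨r, hr⟩ := hL; have := NeZero.ne L; omega⟩
  set PX : Finset (Plaquette d L) := plaqsE X with hPX
  set PF : Finset (Plaquette d L) := plaqsE F with hPF
  set PY : Finset (Plaquette d L) := plaqsE Y with hPY
  set PθX : Finset (Plaquette d L) := plaqsE (siteRefl X) with hPθX
  set PθY : Finset (Plaquette d L) := plaqsE (siteRefl Y) with hPθY
  have hθX : PθX = PX.image sitePlaqReflect := plaqsE_siteRefl X
  have hθY : PθY = PY.image sitePlaqReflect := plaqsE_siteRefl Y
  have dXF : Disjoint PX PF := disjoint_plaqsE hXF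
  have dXFY : Disjoint (PX ∪ PF) PY := by rw [hPX, hPF, ← plaqsE_union]; exact disjoint_plaqsE hXFY
  have dXFθ : Disjoint (PX ∪ PF) PθX := by rw [hPX, hPF, ← plaqsE_union]; exact disjoint_plaqsE hXFθ
  have dθFY : Disjoint (PθY ∪ PF) PY := by rw [hPθY, hPF, ← plaqsE_union]; exact disjoint_plaqsE hθFY
  have dθF : Disjoint PθY PF := disjoint_plaqsE hθF
  have hθθY : PθY.image sitePlaqReflect = PY := by
    rw [hθY, Finset.image_image]
    convert Finset.image_id (s := PY) using 2
    funext q; exact sitePlaqReflect_sitePlaqReflect q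
  -- the shared weight `V² = expObs c PF`, `V` reflection invariant, living on the shared links
  set V : GaugeConfig d L G → ℝ := expObs ρ (c / 2) PF with hV
  have hVsq : ∀ U, expObs ρ c PF U = V U * V U := fun U => by
    rw [hV, expObs, expObs, ← Real.exp_add]; congr 1; ring
  have hVΘ : ∀ U : GaugeConfig d L G, V U.negReflect = V U := fun U =>
    expObs_negReflect_of_isSharedPlaq ρ hL hρ (c / 2) hF U
  obtain ⟨V₀, hVb⟩ := exists_abs_expObs_le (G := G) ρ hρ (c / 2) PF
  have hVdep : DependsOn V ((sitePosEdges ∪ sharedEdges : Finset (Edge d L)) : Set (Edge d L)) :=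
    dependsOn_expObs_of_sitePos_or_shared ρ hL (c / 2) fun q hq => Or.inr (hF q hq)
  -- the two half-observables
  set A₁ : GaugeConfig d L G → ℝ := fun U => expObs ρ c PX U * V U with hA₁
  set B₁ : GaugeConfig d L G → ℝ := fun U => expObs ρ c PθY U * V U with hB₁
  obtain ⟨X₀, hXb⟩ := exists_abs_expObs_le (G := G) ρ hρ c PX
  obtain ⟨Y₀, hYb⟩ := exists_abs_expObs_le (G := G) ρ hρ c PθY
  have hA₁m : Measurable A₁ := (measurable_expObs ρ hρ c _).mul (measurable_expObs ρ hρ _ _)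
  have hB₁m : Measurable B₁ := (measurable_expObs ρ hρ c _).mul (measurable_expObs ρ hρ _ _)
  have hA₁b : ∀ U, |A₁ U| ≤ X₀ * V₀ := fun U => by
    rw [hA₁]; simp only; rw [abs_mul]
    exact mul_le_mul (hXb U) (hVb U) (abs_nonneg _) ((abs_nonneg _).trans (hXb U))
  have hB₁b : ∀ U, |B₁ U| ≤ Y₀ * V₀ := fun U => by
    rw [hB₁]; simp only; rw [abs_mul]
    exact mul_le_mul (hYb U) (hVb U) (abs_nonneg _) ((abs_nonneg _).trans (hYb U))
  have hA₁dep : DependsOn A₁ ((sitePosEdges ∪ sharedEdges : Finset (Edge d L)) : Set (Edge d L)) := fun U W hUW => by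
    simp only [hA₁]
    rw [dependsOn_expObs_of_sitePos_or_shared ρ hL c (fun q hq => Or.inl (hX q hq)) hUW, hVdep hUW]
  have hB₁dep : DependsOn B₁ ((sitePosEdges ∪ sharedEdges : Finset (Edge d L)) : Set (Edge d L)) := fun U W hUW => by
    simp only [hB₁]
    rw [dependsOn_expObs_of_sitePos_or_shared ρ hL c (fun q hq => Or.inl (hY q hq)) hUW, hVdep hUW]
  have key := sq_integral_mul_negReflect_le ρ hL hρ β hA₁m hA₁b hA₁dep hB₁m hB₁b hB₁dep
  -- identify the three integrals
  have hYΘ : ∀ U : GaugeConfig d L G, expObs ρ c PθY U.negReflect = expObs ρ c PY U := by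
    intro U; rw [expObs_negReflect ρ hρ, hθθY]
  have hXΘ : ∀ U : GaugeConfig d L G, expObs ρ c PX U.negReflect = expObs ρ c PθX U := by
    intro U; rw [expObs_negReflect ρ hρ, hθX]
  have e1 : (∫ U, A₁ U * B₁ U.negReflect ∂(wilsonMeasure ρ β)) = mpsiE ρ β c (fun o => X o ∪ F o ∪ Y o) := by
    unfold mpsiE wilsonExpectation
    refine integral_congr_ae (ae_of_all _ fun U => ?_)
    simp only [hA₁, hB₁]
    rw [plaqsE_union₃, ← hPX, ← hPF, ← hPY, ← expObs_mul_of_disjoint ρ c dXFY, ← expObs_mul_of_disjoint ρ c dXF,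
      hYΘ, hVΘ, hVsq]
    ring
  have e2 : (∫ U, A₁ U * A₁ U.negReflect ∂(wilsonMeasure ρ β)) = mpsiE ρ β c (fun o => X o ∪ F o ∪ siteRefl X o) := by
    unfold mpsiE wilsonExpectation
    refine integral_congr_ae (ae_of_all _ fun U => ?_)
    simp only [hA₁]
    rw [plaqsE_union₃, ← hPX, ← hPF, ← hPθX, ← expObs_mul_of_disjoint ρ c dXFθ,
      ← expObs_mul_of_disjoint ρ c dXF, hXΘ, hVΘ, hVsq]
    ring
  have e3 : (∫ U, B₁ U * B₁ U.negReflect ∂(wilsonMeasure ρ β)) = mpsiE ρ β c (fun o => siteRefl Y o ∪ F o ∪ Y o) := by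
    unfold mpsiE wilsonExpectation
    refine integral_congr_ae (ae_of_all _ fun U => ?_)
    simp only [hB₁]
    rw [plaqsE_union₃, ← hPθY, ← hPF, ← hPY, ← expObs_mul_of_disjoint ρ c dθFY,
      ← expObs_mul_of_disjoint ρ c dθF, hYΘ, hVΘ, hVsq]
    ring
  rw [e1, e2, e3] at key
  exact key

end SiteCore

/-! ### §4. The two Schwarz inequalities of the axis `0` -/

section Zero

omit [NeZero d] [NeZero L] in
/-- In-plane components of `plaqsE` membership. -/
theorem mem_plaqsE_cases {A : Orient d → Finset (BlockIdx d L)} {q : Plaquette d L} (hq : q ∈ plaqsE A) :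
    q = (q.1, q.2) ∧ q.1 ∈ A q.2 := ⟨rfl, mem_plaqsE.1 hq⟩

/-- **The LINK Schwarz inequality of `Ψ` in the axis `0`** (`L` even, `0 ≤ c ≤ β`). -/
theorem mpsiE_link_sq_le_zero (hL : Even L) (hρ : Continuous ρ) {β c : ℝ} (hc : 0 ≤ c) (hcβ : c ≤ β)
    (A : Orient d → Finset (BlockIdx d L)) :
    mpsiE (G := G) ρ β c A ^ 2 ≤
      mpsiE ρ β c (fun o => if o.1.1 = 0 then ssymP 0 0 (A o) else symP 0 1 (A o)) *
        mpsiE ρ β c (fun o => if o.1.1 = 0 then ssymM 0 0 (A o) else symM 0 1 (A o)) := by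
  set X : Orient d → Finset (BlockIdx d L) :=
    fun o => if o.1.1 = 0 then sRowsX 0 (A o) else A o ∩ halfPlus L 0 1 with hX
  set F : Orient d → Finset (BlockIdx d L) := fun o => if o.1.1 = 0 then sRowsF 0 (A o) else ∅ with hF
  set Y : Orient d → Finset (BlockIdx d L) :=
    fun o => if o.1.1 = 0 then sRowsY 0 (A o) else A o ∩ halfMinus L 0 1 with hY
  have hsf := fun o : Orient d => sRows_facts (d := d) hL (0 : ZMod L) (A o)
  have hof := fun o : Orient d => oRows_facts (d := d) hL (1 : ZMod L) (A o)
  have hA : A = fun o => X o ∪ F o ∪ Y o := by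
    funext o
    by_cases ho : o.1.1 = 0
    · simp only [hX, hF, hY, ho, ↓reduceIte]; exact (hsf o).1
    · simp only [hX, hF, hY, ho, ↓reduceIte]; exact (hof o).1
  have hP : (fun o => if o.1.1 = 0 then ssymP 0 0 (A o) else symP 0 1 (A o)) =
      fun o => X o ∪ F o ∪ linkRefl X o := by
    funext o
    by_cases ho : o.1.1 = 0
    · simp only [hX, hF, linkRefl, ho, ↓reduceIte]; exact (hsf o).2.1
    · simp only [hX, hF, linkRefl, ho, ↓reduceIte]; exact (hof o).2.1
  have hM : (fun o => if o.1.1 = 0 then ssymM 0 0 (A o) else symM 0 1 (A o)) =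
      fun o => linkRefl Y o ∪ F o ∪ Y o := by
    funext o
    by_cases ho : o.1.1 = 0
    · simp only [hY, hF, linkRefl, ho, ↓reduceIte]; exact (hsf o).2.2.1
    · simp only [hY, hF, linkRefl, ho, ↓reduceIte]; exact (hof o).2.2.1
  rw [hP, hM]
  conv_lhs => rw [hA]
  refine mpsiE_link_core ρ hL hρ hc hcβ ?_ ?_ ?_ ?_ ?_ ?_ ?_ ?_
  · intro o; by_cases ho : o.1.1 = 0
    · simp only [hX, hF, ho, ↓reduceIte]; exact (hsf o).2.2.2.1
    · simp only [hX, hF, ho, ↓reduceIte]; exact (hof o).2.2.2.1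
  · intro o; by_cases ho : o.1.1 = 0
    · simp only [hX, hF, hY, ho, ↓reduceIte]; exact (hsf o).2.2.2.2.1
    · simp only [hX, hF, hY, ho, ↓reduceIte]; exact (hof o).2.2.2.2.1
  · intro o; by_cases ho : o.1.1 = 0
    · simp only [hX, hF, linkRefl, ho, ↓reduceIte]; exact (hsf o).2.2.2.2.2.1
    · simp only [hX, hF, linkRefl, ho, ↓reduceIte]; exact (hof o).2.2.2.2.2.1
  · intro o; by_cases ho : o.1.1 = 0
    · simp only [hF, hY, linkRefl, ho, ↓reduceIte]; exact (hsf o).2.2.2.2.2.2.1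
    · simp only [hF, hY, linkRefl, ho, ↓reduceIte]; exact (hof o).2.2.2.2.2.2.1
  · intro o; by_cases ho : o.1.1 = 0
    · simp only [hF, hY, linkRefl, ho, ↓reduceIte]; exact (hsf o).2.2.2.2.2.2.2
    · simp only [hF, hY, linkRefl, ho, ↓reduceIte]; exact (hof o).2.2.2.2.2.2.2
  · intro q hq
    obtain ⟨hq1, hq2⟩ := mem_plaqsE_cases hq
    rw [hq1]
    by_cases ho : q.2.1.1 = 0
    · simp only [hX, ho, ↓reduceIte, sRowsX, mem_sdiff, mem_inter] at hq2
      exact isPosPlaq_of_mem_sRowsX hL ho hq2.1.2 hq2.2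
    · simp only [hX, ho, ↓reduceIte, mem_inter] at hq2
      exact isPosPlaq_of_mem_halfPlus_one hL ho hq2.2
  · intro q hq
    obtain ⟨hq1, hq2⟩ := mem_plaqsE_cases hq
    rw [hq1]
    by_cases ho : q.2.1.1 = 0
    · simp only [hY, linkRefl, ho, ↓reduceIte, sRowsY, mem_image, mem_sdiff] at hq2
      obtain ⟨y, ⟨-, hyP⟩, hyq⟩ := hq2
      rw [← hyq]
      exact isPosPlaq_sreflect_of_not_mem_shalfP hL ho hyP
    · simp only [hY, linkRefl, ho, ↓reduceIte, mem_image, mem_inter] at hq2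
      obtain ⟨y, ⟨-, hyM⟩, hyq⟩ := hq2
      rw [← hyq]
      exact isPosPlaq_cellReflect_of_mem_halfMinus_one hL ho hyM
  · intro q hq
    obtain ⟨hq1, hq2⟩ := mem_plaqsE_cases hq
    rw [hq1]
    by_cases ho : q.2.1.1 = 0
    · simp only [hF, ho, ↓reduceIte, sRowsF, mem_inter] at hq2
      exact isCrossPlaq_of_mem_sRowsF hL ho hq2.1.2 hq2.2
    · simp only [hF, ho, ↓reduceIte] at hq2
      exact absurd hq2 (Finset.notMem_empty _)

/-- **The SITE Schwarz inequality of `Ψ` in the axis `0`** (`L` even; every real `β`, `c`). -/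
theorem mpsiE_site_sq_le_zero (hL : Even L) (hρ : Continuous ρ) (β c : ℝ) (A : Orient d → Finset (BlockIdx d L)) :
    mpsiE (G := G) ρ β c A ^ 2 ≤
      mpsiE ρ β c (fun o => if o.1.1 = 0 then symP 0 0 (A o) else ssymP 0 0 (A o)) *
        mpsiE ρ β c (fun o => if o.1.1 = 0 then symM 0 0 (A o) else ssymM 0 0 (A o)) := by
  set X : Orient d → Finset (BlockIdx d L) :=
    fun o => if o.1.1 = 0 then A o ∩ halfPlus L 0 0 else sRowsX 0 (A o) with hX
  set F : Orient d → Finset (BlockIdx d L) := fun o => if o.1.1 = 0 then ∅ else sRowsF 0 (A o) with hF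
  set Y : Orient d → Finset (BlockIdx d L) :=
    fun o => if o.1.1 = 0 then A o ∩ halfMinus L 0 0 else sRowsY 0 (A o) with hY
  have hsf := fun o : Orient d => sRows_facts (d := d) hL (0 : ZMod L) (A o)
  have hof := fun o : Orient d => oRows_facts (d := d) hL (0 : ZMod L) (A o)
  have hA : A = fun o => X o ∪ F o ∪ Y o := by
    funext o
    by_cases ho : o.1.1 = 0
    · simp only [hX, hF, hY, ho, ↓reduceIte]; exact (hof o).1
    · simp only [hX, hF, hY, ho, ↓reduceIte]; exact (hsf o).1
  have hP : (fun o => if o.1.1 = 0 then symP 0 0 (A o) else ssymP 0 0 (A o)) =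
      fun o => X o ∪ F o ∪ siteRefl X o := by
    funext o
    by_cases ho : o.1.1 = 0
    · simp only [hX, hF, siteRefl, ho, ↓reduceIte]; exact (hof o).2.1
    · simp only [hX, hF, siteRefl, ho, ↓reduceIte]; exact (hsf o).2.1
  have hM : (fun o => if o.1.1 = 0 then symM 0 0 (A o) else ssymM 0 0 (A o)) =
      fun o => siteRefl Y o ∪ F o ∪ Y o := by
    funext o
    by_cases ho : o.1.1 = 0
    · simp only [hY, hF, siteRefl, ho, ↓reduceIte]; exact (hof o).2.2.1
    · simp only [hY, hF, siteRefl, ho, ↓reduceIte]; exact (hsf o).2.2.1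
  rw [hP, hM]
  conv_lhs => rw [hA]
  refine mpsiE_site_core ρ hL hρ β c ?_ ?_ ?_ ?_ ?_ ?_ ?_ ?_
  · intro o; by_cases ho : o.1.1 = 0
    · simp only [hX, hF, ho, ↓reduceIte]; exact (hof o).2.2.2.1
    · simp only [hX, hF, ho, ↓reduceIte]; exact (hsf o).2.2.2.1
  · intro o; by_cases ho : o.1.1 = 0
    · simp only [hX, hF, hY, ho, ↓reduceIte]; exact (hof o).2.2.2.2.1
    · simp only [hX, hF, hY, ho, ↓reduceIte]; exact (hsf o).2.2.2.2.1
  · intro o; by_cases ho : o.1.1 = 0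
    · simp only [hX, hF, siteRefl, ho, ↓reduceIte]; exact (hof o).2.2.2.2.2.1
    · simp only [hX, hF, siteRefl, ho, ↓reduceIte]; exact (hsf o).2.2.2.2.2.1
  · intro o; by_cases ho : o.1.1 = 0
    · simp only [hF, hY, siteRefl, ho, ↓reduceIte]; exact (hof o).2.2.2.2.2.2.1
    · simp only [hF, hY, siteRefl, ho, ↓reduceIte]; exact (hsf o).2.2.2.2.2.2.1
  · intro o; by_cases ho : o.1.1 = 0
    · simp only [hF, hY, siteRefl, ho, ↓reduceIte]; exact (hof o).2.2.2.2.2.2.2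
    · simp only [hF, hY, siteRefl, ho, ↓reduceIte]; exact (hsf o).2.2.2.2.2.2.2
  · intro q hq
    obtain ⟨hq1, hq2⟩ := mem_plaqsE_cases hq
    rw [hq1]
    by_cases ho : q.2.1.1 = 0
    · simp only [hX, ho, ↓reduceIte, mem_inter] at hq2
      exact isSitePosPlaq_of_mem_halfPlus_zero hL ho hq2.2
    · simp only [hX, ho, ↓reduceIte, sRowsX, mem_sdiff, mem_inter] at hq2
      exact isSitePosPlaq_of_mem_sRowsX hL ho hq2.1.2 hq2.2
  · intro q hq
    obtain ⟨hq1, hq2⟩ := mem_plaqsE_cases hq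
    rw [hq1]
    by_cases ho : q.2.1.1 = 0
    · simp only [hY, siteRefl, ho, ↓reduceIte, mem_image, mem_inter] at hq2
      obtain ⟨y, ⟨-, hyM⟩, hyq⟩ := hq2
      rw [← hyq]
      exact isSitePosPlaq_cellReflect_of_mem_halfMinus_zero hL ho hyM
    · simp only [hY, siteRefl, ho, ↓reduceIte, sRowsY, mem_image, mem_sdiff] at hq2
      obtain ⟨y, ⟨-, hyP⟩, hyq⟩ := hq2
      rw [← hyq]
      exact isSitePosPlaq_sreflect_of_not_mem_shalfP hL ho hyP
  · intro q hq
    obtain ⟨hq1, hq2⟩ := mem_plaqsE_cases hq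
    rw [hq1]
    by_cases ho : q.2.1.1 = 0
    · simp only [hF, ho, ↓reduceIte] at hq2
      exact absurd hq2 (Finset.notMem_empty _)
    · simp only [hF, ho, ↓reduceIte, sRowsF, mem_inter] at hq2
      exact isSharedPlaq_of_mem_sRowsF hL ho hq2.1.2 hq2.2

end Zero

end Summit.QuantumFields.YangMills.Theorems.AllSidesChessboard

end
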